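import Literature.NumberTheory.PAdicHodge.KummerFilZeroCoboundarySupersingular
import Literature.NumberTheory.EllipticCurves.FormalGroupNilIdealPointsGalois
import HarnessLib

/-!
# The Tate-module matching carries the ALGEBRAIC Kummer cocycle of a rational formal point to the formal-group Kummer cocycle

Topic `Literature/NumberTheory/PAdicHodge`; namespace `Literature.NumberTheory.PAdicHodge.AinfTop`. THEOREMS ONLY (no definition, no
named fact, no instance, no `sorry`). Setting: `W/ℤ`, `p` an odd prime of good SUPERSINGULAR reduction (`p ∤ Δ_W`, `A_p(W mod p) = 0`),
`F` a `p`-adic field, `E = curveF F W = W ×_ℤ F`, and the matching `e = tateGeomEquivTatePtSS : T_pE(F̄) ≃ T_pŴ(𝒪_{ℂ_F})`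
(`AinfWeierstrassTateModuleSupersingular`; components `z(P_n)`, AEC VII.2.2).

The K1 capstone `isFilZeroCoboundary_kummerCocycle_curveF(_of_five_le)` (file `KummerFilZeroCoboundarySupersingular`) is phrased with
the FORMAL-GROUP Kummer cocycle `κ_u(σ) = (σuₙ ⊖ uₙ)ₙ ∈ T_pŴ(𝒪_{ℂ_F})` of a `[p]_W`-division sequence `u` of points of `Ŵ(𝔪_{ℂ_F})`.
The Kummer cocycle of arithmetic is the ALGEBRAIC one: for a point `P ∈ E(F̄)` and a `p`-power division sequence `Q` of `P` in
`E(F̄)` (`p • Q_{n+1} = Q_n`, `Q₀ = P`), `σ ↦ (σQₙ − Qₙ)ₙ ∈ T_pE(F̄)`. This file identifies the two under `e` when `P` is a point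
of the FORMAL GROUP (`P ∈ E₁`) fixed by `Γ_F`:

* §1 `mem_kernel_iff_reducesToZero` (the tree's two descriptions of `E₁(ℂ_F)`), **`geomToC_divSeq_mem_kernel`** — at good
  supersingular reduction every `p`-power division point of a point of `E₁` lies in `E₁` (the reduction has no `p`-torsion:
  `reducesToZero_of_pow_prime_smul_reducesToZero`);
* §2 the algebraic Kummer element `kummerElt Q σ = (σQₙ − Qₙ)ₙ ∈ T_pE(F̄)` (`TateModule.mk`; compatibilities `pow_smul_kummer_eq_zero`,
  `smul_kummer_succ` from `p • Q_{n+1} = Q_n` and `σQ₀ = Q₀`) and its components;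
* §3 **`proj_tateGeomEquivTatePtSS`**: the `n`-th component of `e(τ)` is `z(τₙ)` read through AEC VII.2.2 `kernelEquivPt`;
* §4 ★ **`tateGeomEquivTatePtSS_kummer`**: `e((σQₙ − Qₙ)ₙ) = κ_u(σ)` for `uₙ := z(Qₙ)` (`z` is an equivariant isomorphism
  `E₁(ℂ_F) ≅ Ŵ(𝔪_{ℂ_F})`); `mulPC_zPt_divSeq`, `galCBall_zPt_divSeq_zero` — `u` IS a `[p]_W`-division sequence with `Γ_F`-fixed base;
* §5 ★★ **`isFilZeroCoboundary_kummer_curveF_of_five_le`**: for `p ≥ 5`, a `Γ_F`-fixed point `P ∈ E₁` admitting a `Γ_F`-fixed lift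
  to `Ŵ(𝔫)` (e.g. `P` with coordinates in `W(k_F)`, tree `wittPt`/`zpPt`) and ANY division sequence `Q` of `P` in `E(F̄)`:
  `σ ↦ 1 ⊗ (σQₙ − Qₙ)ₙ` is a `Fil⁰`-coboundary of `B_dR(F) ⊗ V_pE` — K1 in the currency of the Kummer theory of `E`, no formal
  group in the statement of the cocycle.

Brick K1 of the hT₂ programme (crux K★ `stmt-BirchSwinnertonDyer-22226`): the first half of the bridge «κ_u ↔ Kummer classes of `E(F)`»;
the other half (from `kummerLocalConditionAt` at all levels to a division sequence; the index `[E(F) : E₁(F)]`) is not here.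
BSD / K★ are not proved by any of this.

## References
* [SilvermanAEC2009] J. H. Silverman, *AEC* (2009), Prop. VII.2.1–VII.2.2 (`E₁ ≅ Ê(𝔪)`), VIII.§2 (the Kummer pairing), III.§7.
* [BlochKato1990] S. Bloch, K. Kato (1990), Ex. 3.10.1, Example 3.11.
* [Serre1972] J.-P. Serre, Invent. Math. 15 (1972), §1.11.
-/

noncomputable section

open scoped TensorProduct Classical

namespace Literature.NumberTheory.PAdicHodge

open Literature Literature.NumberTheory.GaloisRepresentations Literature.NumberTheory.EllipticCurves WeierstrassCurve
open Literature.NumberTheory.GaloisRepresentations.IsNonarchimedeanLocalField Field ValuativeRel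
open Literature.NumberTheory.GaloisRepresentations.LubinTate Literature.NumberTheory.EllipticCurves.FormalGroupChart

namespace AinfTop

section Kernel

variable {F : Type} [Field F] [ValuativeRel F] [TopologicalSpace F] [IsNonarchimedeanLocalField F]
  (W : WeierstrassCurve ℤ) {p : ℕ}

/-! ## §1 Division points of formal points are formal -/

/-- `pⁿ • Qₙ = Q₀` along a `p`-power division sequence. [cite: SilvermanAEC2009, III.§7] -/
theorem pow_smul_divSeq {A : Type*} [AddCommGroup A] {Q : ℕ → A} (hQ : ∀ n, p • Q (n + 1) = Q n) (n : ℕ) :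
    p ^ n • Q n = Q 0 := by
  induction n with
  | zero => rw [pow_zero, one_smul]
  | succ n ih => rw [pow_succ, mul_smul, hQ, ih]

/-- The two descriptions of `E₁(ℂ_F)` in the tree agree: `P ∈ kernel` (`FormalGroupChart.kernel`: `‖x(P)‖ > 1`) iff `P` reduces to `Õ`
for the integral model `W ⊗ 𝒪_{ℂ_F}` (`WeierstrassCurve.ReducesToZero`: `x(P) ∉ 𝒪_{ℂ_F}`). [cite: SilvermanAEC2009, Prop. VII.2.2] -/
theorem mem_kernel_iff_reducesToZero (P : (curveOver (CompletedAlgClosure F) W).toAffine.Point) :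
    P ∈ kernel (NormedField.valuation (K := CompletedAlgClosure F)) (curveOver (CompletedAlgClosure F) W) ↔
      WeierstrassCurve.ReducesToZero (ballIntModel (CompletedAlgClosure F) W) P := by
  rcases P with _ | ⟨x, y, h⟩
  · exact ⟨fun _ => WeierstrassCurve.reducesToZero_zero (W := ballIntModel (CompletedAlgClosure F) W),
      fun _ => (kernel (NormedField.valuation (K := CompletedAlgClosure F)) (curveOver (CompletedAlgClosure F) W)).zero_mem⟩
  · exact (some_mem_kernel_iff h).trans
      ((not_mem_range_iff (Valuation.integer.integers (NormedField.valuation (K := CompletedAlgClosure F)))).symm.trans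
        (WeierstrassCurve.reducesToZero_some_iff (W := ballIntModel (CompletedAlgClosure F) W) h).symm)

variable [Fact p.Prime]

/-- **At good supersingular reduction, `pⁿ`-division points of points of `E₁(ℂ_F)` lie in `E₁(ℂ_F)`** (`W/ℤ`, `p` odd, `p ∤ Δ_W`,
`A_p(W mod p) = 0`): the reduction has no `p`-torsion. [cite: SilvermanAEC2009, Prop. VII.2.1 and Thm. V.3.1(a)] [cite: Serre1972, §1.11] -/
theorem mem_kernel_of_pow_smul_mem_kernel (hp : ‖(p : CompletedAlgClosure F)‖ < 1) (hp2 : p ≠ 2) (hΔ : ¬ (p : ℤ) ∣ W.Δ)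
    (hA : (W.map (Int.castRingHom (ZMod p))).hasseCoeff p = 0) (n : ℕ) {Q : (curveOver (CompletedAlgClosure F) W).toAffine.Point}
    (hQ : p ^ n • Q ∈ kernel (NormedField.valuation (K := CompletedAlgClosure F)) (curveOver (CompletedAlgClosure F) W)) :
    Q ∈ kernel (NormedField.valuation (K := CompletedAlgClosure F)) (curveOver (CompletedAlgClosure F) W) := by
  rw [mem_kernel_iff_reducesToZero] at hQ ⊢
  refine reducesToZero_of_pow_prime_smul_reducesToZero (Valuation.integer.integers _) (isUnit_Δ_ballIntModel W hp hΔ)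
    (reduction_no_pTorsion W hp hp2 hΔ hA) (n := n) ?_
  have hQ' : WeierstrassCurve.ReducesToZero (ballIntModel (CompletedAlgClosure F) W) (((p ^ n : ℕ) : ℤ) • Q) := by
    rwa [natCast_zsmul]
  rw [Nat.cast_pow] at hQ'
  exact hQ'

variable [CharZero F] [(curveF F W).IsElliptic]

omit [CharZero F] [(curveF F W).IsElliptic] in
/-- **Every point of a `p`-power division sequence of a point of `E₁` lies in `E₁(ℂ_F)`** (read through `E(F̄) → E(ℂ_F)`), at good
supersingular reduction. [cite: SilvermanAEC2009, Prop. VII.2.1] [cite: Serre1972, §1.11] -/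
theorem geomToC_divSeq_mem_kernel (hp : ‖(p : CompletedAlgClosure F)‖ < 1) (hp2 : p ≠ 2) (hΔ : ¬ (p : ℤ) ∣ W.Δ)
    (hA : (W.map (Int.castRingHom (ZMod p))).hasseCoeff p = 0) {Q : ℕ → (curveF F W).geomPoints}
    (hQ : ∀ n, p • Q (n + 1) = Q n)
    (hQ0 : geomToC W (Q 0) ∈ kernel (NormedField.valuation (K := CompletedAlgClosure F)) (curveOver (CompletedAlgClosure F) W))
    (n : ℕ) : geomToC W (Q n) ∈ kernel (NormedField.valuation (K := CompletedAlgClosure F)) (curveOver (CompletedAlgClosure F) W) := by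
  refine mem_kernel_of_pow_smul_mem_kernel W hp hp2 hΔ hA n ?_
  rw [← map_nsmul, pow_smul_divSeq hQ]
  exact hQ0

end Kernel

section Matching

variable {F : Type} [Field F] [ValuativeRel F] [TopologicalSpace F] [IsNonarchimedeanLocalField F] [CharZero F]
  (W : WeierstrassCurve ℤ) {p : ℕ} [Fact p.Prime] [(curveF F W).IsElliptic] [hE : (curveOver (CompletedAlgClosure F) W).IsElliptic]

/-! ## §2 The algebraic Kummer element of a division sequence -/

omit [ValuativeRel F] [TopologicalSpace F] [IsNonarchimedeanLocalField F] [CharZero F] [Fact (Nat.Prime p)]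
  [(curveF F W).IsElliptic] hE in
/-- `pⁿ • (σQₙ − Qₙ) = σQ₀ − Q₀ = 0` for a division sequence with `Γ_F`-fixed base. [cite: SilvermanAEC2009, VIII.§2] -/
theorem pow_smul_kummer_eq_zero {Q : ℕ → (curveF F W).geomPoints} (hQ : ∀ n, p • Q (n + 1) = Q n)
    (hfix : ∀ σ : absoluteGaloisGroup F, σ • Q 0 = Q 0) (σ : absoluteGaloisGroup F) (n : ℕ) : p ^ n • (σ • Q n - Q n) = 0 := by
  have h : p ^ n • (σ • Q n) = σ • (p ^ n • Q n) := (map_nsmul (DistribSMul.toAddMonoidHom _ σ) (p ^ n) (Q n)).symm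
  rw [smul_sub, h, pow_smul_divSeq hQ, hfix, sub_self]

omit [ValuativeRel F] [TopologicalSpace F] [IsNonarchimedeanLocalField F] [CharZero F] [Fact (Nat.Prime p)]
  [(curveF F W).IsElliptic] hE in
/-- `p • (σQ_{n+1} − Q_{n+1}) = σQₙ − Qₙ`. [cite: SilvermanAEC2009, VIII.§2] -/
theorem smul_kummer_succ {Q : ℕ → (curveF F W).geomPoints} (hQ : ∀ n, p • Q (n + 1) = Q n) (σ : absoluteGaloisGroup F) (n : ℕ) :
    p • (σ • Q (n + 1) - Q (n + 1)) = σ • Q n - Q n := by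
  have h : p • (σ • Q (n + 1)) = σ • (p • Q (n + 1)) := (map_nsmul (DistribSMul.toAddMonoidHom _ σ) p (Q (n + 1))).symm
  rw [smul_sub, h, hQ]

/-! ## §3 Components of the matching -/

omit [(curveF F W).IsElliptic] in
/-- **The `n`-th component of `e(τ)` is the formal point of `τₙ`**: `e(τ)ₙ = kernelEquivPt(ι τₙ)` (`ι : E(F̄) → E(ℂ_F)`, `z(P) = −x/y`).
[cite: SilvermanAEC2009, Prop. VII.2.2] -/
theorem proj_tateGeomEquivTatePtSS (hp : ‖(p : CompletedAlgClosure F)‖ < 1) (hp2 : p ≠ 2) (hΔ : ¬ (p : ℤ) ∣ W.Δ)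
    (hA : (W.map (Int.castRingHom (ZMod p))).hasseCoeff p = 0) (τ : (curveF F W).tateModule p) (n : ℕ)
    (h : geomToC W (TateModule.proj p n τ) ∈ kernel (NormedField.valuation (K := CompletedAlgClosure F)) (curveOver (CompletedAlgClosure F) W)) :
    TateModule.proj p n (tateGeomEquivTatePtSS F W p hp hp2 hΔ hA τ) =
      kernelEquivPt (CompletedAlgClosure F) W ⟨geomToC W (TateModule.proj p n τ), h⟩ := by
  refine WeierstrassCurve.Pt.ext (Subtype.ext (Subtype.ext ?_))
  have h1 : ((((TateModule.proj p n (tateGeomEquivTatePtSS F W p hp hp2 hΔ hA τ)).val : (maxNilIdealC F).toIdeal) : CBall F) :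
      CompletedAlgClosure F) = (TateModule.proj p n (tateGeomEquivC F W p (fun h0 => hΔ (h0 ▸ dvd_zero _)) τ)).zCoord := rfl
  rw [h1, proj_tateGeomEquivC, kernelEquivPt_apply_val, coe_zPt]

/-! ## §4 `e(algebraic Kummer element) = κ_u` -/

omit [CharZero F] [Fact (Nat.Prime p)] [(curveF F W).IsElliptic] in
/-- The formal coordinates `uₙ := z(Qₙ)` of a division sequence of a formal point form a `[p]_W`-division sequence of points of
`Ŵ(𝔪_{ℂ_F})` (`z(p • Q) = [p]_W z(Q)`, AEC VII.2.2). [cite: SilvermanAEC2009, Prop. VII.2.2] -/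
theorem mulPC_zPt_divSeq {Q : ℕ → (curveF F W).geomPoints} (hQ : ∀ n, p • Q (n + 1) = Q n)
    (hker : ∀ n, geomToC W (Q n) ∈ kernel (NormedField.valuation (K := CompletedAlgClosure F)) (curveOver (CompletedAlgClosure F) W))
    (n : ℕ) : mulPC F p W (zPt (geomToC W (Q (n + 1))) (hker (n + 1))) = zPt (geomToC W (Q n)) (hker n) := by
  have h := congrArg WeierstrassCurve.Pt.val
    (map_nsmul (kernelEquivPt (CompletedAlgClosure F) W) p ⟨geomToC W (Q (n + 1)), hker (n + 1)⟩)
  have h2 : p • (⟨geomToC W (Q (n + 1)), hker (n + 1)⟩ :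
      kernel (NormedField.valuation (K := CompletedAlgClosure F)) (curveOver (CompletedAlgClosure F) W)) =
      ⟨geomToC W (Q n), hker n⟩ := Subtype.ext (by
    change p • geomToC W (Q (n + 1)) = geomToC W (Q n)
    rw [← map_nsmul, hQ])
  rw [h2] at h
  calc mulPC F p W (zPt (geomToC W (Q (n + 1))) (hker (n + 1)))
      = (p • kernelEquivPt (CompletedAlgClosure F) W ⟨geomToC W (Q (n + 1)), hker (n + 1)⟩).val :=
        (val_p_nsmul F W (kernelEquivPt (CompletedAlgClosure F) W ⟨geomToC W (Q (n + 1)), hker (n + 1)⟩)).symm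
    _ = (kernelEquivPt (CompletedAlgClosure F) W ⟨geomToC W (Q n), hker n⟩).val := h.symm
    _ = zPt (geomToC W (Q n)) (hker n) := kernelEquivPt_apply_val _

omit [CharZero F] [(curveF F W).IsElliptic] hE in
/-- The base `u₀ = z(Q₀)` is fixed by `Γ_F` when `Q₀` is. [cite: SilvermanAEC2009, VIII.§2] -/
theorem galCBall_zPt_divSeq_zero {Q : ℕ → (curveF F W).geomPoints} (hfix : ∀ σ : absoluteGaloisGroup F, σ • Q 0 = Q 0)
    (hker : ∀ n, geomToC W (Q n) ∈ kernel (NormedField.valuation (K := CompletedAlgClosure F)) (curveOver (CompletedAlgClosure F) W))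
    (σ : absoluteGaloisGroup F) : galCBall σ (zPt (geomToC W (Q 0)) (hker 0) : CBall F) = zPt (geomToC W (Q 0)) (hker 0) := by
  have h := zCoord_galPointHom (W := W) (CompletedAlgClosure.galRingHom σ) (galRingHom_cK σ) (geomToC W (Q 0))
  change (galPointC W σ (geomToC W (Q 0))).zCoord = _ at h
  rw [← geomToC_smul, hfix] at h
  apply Subtype.ext
  change ((galCBallAlgHom σ (zPt (geomToC W (Q 0)) (hker 0) : CBall F) : CBall F) : CompletedAlgClosure F) = _
  rw [← galRingHom_coe, coe_zPt]
  exact h.symm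

omit [(curveF F W).IsElliptic] in
/-- ★ **The matching carries the algebraic Kummer element to the formal-group Kummer cocycle**: for a `p`-power division sequence `Q`
in `E(F̄)` of a `Γ_F`-fixed point `Q₀ ∈ E₁` (good supersingular reduction), with formal coordinates `uₙ = z(Qₙ) ∈ 𝔪_{ℂ_F}`,
`e((σQₙ − Qₙ)ₙ) = κ_u(σ)` in `T_pŴ(𝒪_{ℂ_F})` (`z : E₁(ℂ_F) ≅ Ŵ(𝔪_{ℂ_F})` is an equivariant isomorphism of groups, AEC VII.2.2).
[cite: SilvermanAEC2009, Prop. VII.2.2 and VIII.§2] [cite: BlochKato1990, Ex. 3.10.1] -/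
theorem tateGeomEquivTatePtSS_kummer (hp : ‖(p : CompletedAlgClosure F)‖ < 1) (hp2 : p ≠ 2) (hΔ : ¬ (p : ℤ) ∣ W.Δ)
    (hA : (W.map (Int.castRingHom (ZMod p))).hasseCoeff p = 0) {Q : ℕ → (curveF F W).geomPoints}
    (hQ : ∀ n, p • Q (n + 1) = Q n) (hfix : ∀ σ : absoluteGaloisGroup F, σ • Q 0 = Q 0)
    (hker : ∀ n, geomToC W (Q n) ∈ kernel (NormedField.valuation (K := CompletedAlgClosure F)) (curveOver (CompletedAlgClosure F) W))
    {hup : ∀ n, mulPC F p W (zPt (geomToC W (Q (n + 1))) (hker (n + 1))) = zPt (geomToC W (Q n)) (hker n)}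
    {hu₀ : ∀ σ : absoluteGaloisGroup F, galCBall σ (zPt (geomToC W (Q 0)) (hker 0) : CBall F) = zPt (geomToC W (Q 0)) (hker 0)}
    (σ : absoluteGaloisGroup F) :
    tateGeomEquivTatePtSS F W p hp hp2 hΔ hA
        (TateModule.mk (fun n => σ • Q n - Q n) (pow_smul_kummer_eq_zero W hQ hfix σ) (smul_kummer_succ W hQ σ)) =
      kummerCocycle W (fun n => zPt (geomToC W (Q n)) (hker n)) hup hu₀ σ := by
  refine TateModule.ext fun n => ?_
  -- the kernel points `A = ι(σ Qₙ) = σ ι(Qₙ)`, `B = ι(Qₙ)`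
  have hB : geomToC W (Q n) ∈ kernel (NormedField.valuation (K := CompletedAlgClosure F)) (curveOver (CompletedAlgClosure F) W) :=
    hker n
  have hAk : galPointC W σ (geomToC W (Q n)) ∈
      kernel (NormedField.valuation (K := CompletedAlgClosure F)) (curveOver (CompletedAlgClosure F) W) :=
    galPointHom_mem_kernel (CompletedAlgClosure.galRingHom σ) (galRingHom_cK σ) (norm_galRingHom σ) (@hB)
  have hAB : geomToC W (TateModule.proj p n
      (TateModule.mk (fun n => σ • Q n - Q n) (pow_smul_kummer_eq_zero W hQ hfix σ) (smul_kummer_succ W hQ σ))) ∈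
      kernel (NormedField.valuation (K := CompletedAlgClosure F)) (curveOver (CompletedAlgClosure F) W) := by
    rw [TateModule.proj_mk, map_sub, geomToC_smul]
    exact (kernel (NormedField.valuation (K := CompletedAlgClosure F)) (curveOver (CompletedAlgClosure F) W)).sub_mem
      (@hAk) (@hB)
  rw [proj_tateGeomEquivTatePtSS W hp hp2 hΔ hA _ n (@hAB), proj_kummerCocycle]
  -- `kernelEquivPt` is additive: `z(A − B) = z(A) − z(B)`
  have hsub : (⟨geomToC W (TateModule.proj p n
      (TateModule.mk (fun n => σ • Q n - Q n) (pow_smul_kummer_eq_zero W hQ hfix σ) (smul_kummer_succ W hQ σ))), hAB⟩ :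
      kernel (NormedField.valuation (K := CompletedAlgClosure F)) (curveOver (CompletedAlgClosure F) W)) =
      ⟨galPointC W σ (geomToC W (Q n)), hAk⟩ - ⟨geomToC W (Q n), hB⟩ := Subtype.ext (by
    change geomToC W (TateModule.proj p n _) = galPointC W σ (geomToC W (Q n)) - geomToC W (Q n)
    rw [TateModule.proj_mk, map_sub, geomToC_smul])
  rw [hsub, map_sub]
  -- `kernelEquivPt` is equivariant: `z(σ B) = σ • z(B)`, and `⟨uₙ⟩ = z(B)` as points
  have hBpt : (⟨zPt (geomToC W (Q n)) (hker n)⟩ : W.Pt (maxNilIdealC F)) =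
      kernelEquivPt (CompletedAlgClosure F) W ⟨geomToC W (Q n), hB⟩ :=
    WeierstrassCurve.Pt.ext (by rw [kernelEquivPt_apply_val])
  have hApt : galPt W σ (kernelEquivPt (CompletedAlgClosure F) W ⟨geomToC W (Q n), hB⟩) =
      kernelEquivPt (CompletedAlgClosure F) W ⟨galPointC W σ (geomToC W (Q n)), hAk⟩ :=
    (kernelEquivPt_galPointHom (CompletedAlgClosure.galRingHom σ) (galRingHom_cK σ) (norm_galRingHom σ)
      (galCBallAlgHom σ) (continuous_galCBall σ) (fun _ hx => galCBall_mem hx) (fun _ => rfl) ⟨geomToC W (Q n), hB⟩).symm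
  rw [hBpt, smul_def, hApt]
  rfl

/-! ## §5 K1 in the currency of the Kummer theory of `E` -/

/-- ★★ **K1 for algebraic Kummer cocycles** (`p ≥ 5`, good supersingular reduction of `W/ℤ`, any `p`-adic `F`): let `Q` be a `p`-power
division sequence in `E(F̄)` of a `Γ_F`-fixed point `Q₀ ∈ E₁` (`hQ0`) whose formal coordinate `u₀` (`= z(Q₀)`, `hu₀Q`) admits a `Γ_F`-fixed lift
`Q̂ ∈ Ŵ(𝔫)` (`θ(Q̂) = u₀`; e.g. `Q₀` with coordinates in `W(k_F)` or `ℤ_p`: tree `wittPt`, `zpPt`). Then the algebraic Kummer cocycle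
`σ ↦ 1 ⊗ (σQₙ − Qₙ)ₙ` is a `Fil⁰`-coboundary of `B_dR(F) ⊗ V_pE`: it is `e⁻¹(κ_u)` by `tateGeomEquivTatePtSS_kummer`, and `κ_u` dies by
`isFilZeroCoboundary_kummerCocycle_curveF_of_five_le`. [cite: BlochKato1990, Ex. 3.10.1, Example 3.11] [cite: SilvermanAEC2009, Prop. VII.2.2] -/
theorem isFilZeroCoboundary_kummer_curveF_of_five_le
    [Fact (¬ IsUnit (p : integerC F))] [IsAdicComplete (Ideal.span {(p : integerC F)}) (integerC F)]
    (hpF : valuation F p < 1) [Algebra ℚ_[p] F]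
    (hp5 : 5 ≤ p) (hΔ : ¬ (p : ℤ) ∣ W.Δ) (hA : (W.map (Int.castRingHom (ZMod p))).hasseCoeff p = 0)
    {Q : ℕ → (curveF F W).geomPoints} (hQ : ∀ n, p • Q (n + 1) = Q n) (hfix : ∀ σ : absoluteGaloisGroup F, σ • Q 0 = Q 0)
    (hQ0 : geomToC W (Q 0) ∈ kernel (NormedField.valuation (K := CompletedAlgClosure F)) (curveOver (CompletedAlgClosure F) W))
    {u₀ : (maxNilIdealC F).toIdeal} (hu₀Q : ((u₀ : CBall F) : CompletedAlgClosure F) = (geomToC W (Q 0)).zCoord)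
    {Qhat : W.Pt (nilTheta F p (surjective_fontaineTheta_integerC hpF))}
    (hQhat : thetaPt W (surjective_fontaineTheta_integerC hpF) Qhat = ⟨u₀⟩)
    (hQhatσ : ∀ σ : absoluteGaloisGroup F, galPtN W (surjective_fontaineTheta_integerC hpF) σ Qhat = Qhat) :
    (bdRPeriodRingData (F := F) (p := p) hpF).IsFilZeroCoboundary (rationalTateRep (curveF F W) p) fun σ =>
      ((1 : (bdRPeriodRingData (F := F) (p := p) hpF).B) ⊗ₜ[ℚ_[p]]
        TateModule.toRational p (TateModule.mk (fun n => σ • Q n - Q n) (pow_smul_kummer_eq_zero W hQ hfix σ)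
          (smul_kummer_succ W hQ σ)) :
        (bdRPeriodRingData (F := F) (p := p) hpF).B ⊗[ℚ_[p]] (curveF F W).rationalTateModule p) := by
  have hp2 : p ≠ 2 := by omega
  have hpC : ‖(p : CompletedAlgClosure F)‖ < 1 := norm_natCast_C_lt_one'
  have hker := geomToC_divSeq_mem_kernel W hpC hp2 hΔ hA hQ hQ0
  have hup := mulPC_zPt_divSeq W (F := F) hQ hker
  have e0 : zPt (geomToC W (Q 0)) (hker 0) = u₀ := Subtype.ext (Subtype.ext (by rw [coe_zPt, hu₀Q]))
  have hQhat' : thetaPt W (surjective_fontaineTheta_integerC hpF) Qhat = ⟨zPt (geomToC W (Q 0)) (hker 0)⟩ := by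
    rw [e0]; exact hQhat
  have h := isFilZeroCoboundary_kummerCocycle_curveF_of_five_le hpF W hp5 hΔ hA
    (u := fun n => zPt (geomToC W (Q n)) (hker n)) hup (Q := Qhat) hQhat' hQhatσ
  have hmain : ∀ σ : absoluteGaloisGroup F,
      (tateGeomEquivTatePtSS F W p norm_natCast_C_lt_one' hp2 hΔ hA).symm
          (kummerCocycle W (fun n => zPt (geomToC W (Q n)) (hker n)) hup (galCBall_base_eq_of_fixedLift W (u := fun n => zPt (geomToC W (Q n)) (hker n)) hQhat' hQhatσ) σ) =
        TateModule.mk (fun n => σ • Q n - Q n) (pow_smul_kummer_eq_zero W hQ hfix σ) (smul_kummer_succ W hQ σ) := fun σ => by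
    rw [LinearEquiv.symm_apply_eq]
    exact (tateGeomEquivTatePtSS_kummer W hpC hp2 hΔ hA hQ hfix hker
      (hup := hup) (hu₀ := galCBall_base_eq_of_fixedLift W (u := fun n => zPt (geomToC W (Q n)) (hker n)) hQhat' hQhatσ) σ).symm
  refine h.congr fun σ => ?_
  rw [hmain σ]

end Matching

end AinfTop

end Literature.NumberTheory.PAdicHodge

end
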